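import Mathlib.Data.Sum.Order
import Literature.MathematicalPhysics.QuantumFieldTheory.Dimock2011to13.QED3GaussianIntegralBound
import HarnessLib

/-!
# Dimock, *Quantum electrodynamics on the 3-torus I*, Appendix B (315)–(319) and LEMMA 22 — Gaussian integration of
# the PRIMED fields with the unprimed fields as spectators: `‖∫F(Ψ,Ψ̄,Ψ′,Ψ̄′)dμ_Γ(Ψ′,Ψ̄′)‖_{h′} ≤ ‖F‖_h` for
# `h′, √‖Γ‖₍₂₎ ≤ h` — PROVED

statement-level skeleton of published theorems with citation tags; proofs where landed; nothing here is a claim about the Yang–Mills mass gap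

**Citation header (reproduction of PUBLISHED work).** J. Dimock, *Quantum electrodynamics on the 3-torus. I. First
step*, arXiv:math-ph/0210020 (2002) [Dimock2002QED3TorusI], **Appendix B**, p.64 L13–30 of the arXiv-v1 text layer
`paper:arxiv-math-ph_0210020`. Writer seat p11 (literature-prover-lit-balaban-p11-g15-0), YM LIT SWEEP item (c) D12;
third file of the App. B cluster (`QED3FermionNorm.lean`: (299), LEMMAS 19–20; `QED3GaussianIntegralBound.lean`:
(309)–(313), LEMMA 21).

**The printed text (p.64 L13–30).** *"Now suppose our Grassman algebra is generated by two sets of basis elements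
`Ψ(y), Ψ̄(y)` and `Ψ′(x), Ψ̄′(x)`. The general element has the form
`F(Ψ,Ψ̄,Ψ′,Ψ̄′) = Σ_{n,m,ℓ,k} (1/(n!m!ℓ!k!)) Σ f_{n,m,ℓ,k}(Y_n,Ȳ_m,X_ℓ,X̄_k) Ψ(Y_n)Ψ̄(Ȳ_m)Ψ′(X_ℓ)Ψ̄′(X̄_k)` (315) where
`f_{n,m,ℓ,k}` is anti-symmetric separately in each of the four groups of variables. The norm is now
`‖F‖_h = Σ h^{n+m+ℓ+k}/(n!m!ℓ!k!) ‖f_{n,m,ℓ,k}‖₁` (316). Gaussian integrals with respect to `Ψ′, Ψ̄′` only are defined in the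
obvious way. They are estimated as follows: **LEMMA 22** If `h′, √‖Γ‖₍₂₎ ≤ h` then
`‖∫ F(Ψ,Ψ̄,Ψ′,Ψ̄′) dμ_Γ(Ψ′,Ψ̄′)‖_{h′} ≤ ‖F‖_h` (317). Proof. The integral is evaluated as
`Σ_{n,m,ℓ} (σ_ℓ/(n!m!(ℓ!)²)) Σ f_{n,m,ℓ,ℓ}(Y_n,Ȳ_m,X_ℓ,X̄_ℓ) det{Γ(x_i,x̄_j)} Ψ(Y_n)Ψ̄(Ȳ_m)` (318). By Hadamard's inequality
the determinant is less than `(‖Γ‖₍₂₎)^ℓ` and this expression has `h′`-norm dominated by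
`Σ_{n,m,ℓ} ((h′)^{n+m}(‖Γ‖₍₂₎)^ℓ/(n!m!(ℓ!)²)) ‖f_{n,m,ℓ,ℓ}‖₁ ≤ ‖F‖_h` (319)."*

**What is here.** The two sets of generators are the two blocks of the index type `ι₁ ⊕ₗ ι₂` (lexicographic sum:
every unprimed letter precedes every primed letter), so the tree's Grassmann algebra `Λ(ι₁ ⊕ₗ ι₂) =
QuantumLattice.GrassmannAlgebra 𝕜 (ι₁ ⊕ₗ ι₂)` IS the algebra of (315), and its monomial basis factorises WITHOUT SIGN:
`θ_S = θ_{S₁} θ′_{S₂}` (`grassmannBasis_sumLex`; `S₁ = fstPart S`, `S₂ = sndPart S`, `#S = #S₁ + #S₂`), the embeddings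
of the two sub-algebras being `mapFst`, `mapSnd` (Mathlib's `ExteriorAlgebra.map` along the order embeddings
`inlEmb`, `inrEmb`; monomials go to monomials, `map_extendByZero_grassmannBasis`). (316) is then the norm `hNorm h` of
`QED3FermionNorm.lean` on `Λ(ι₁ ⊕ₗ ι₂)` (one `h^{#S}|c_S|` per monomial, `#S = n+m+ℓ+k`). *"Gaussian integrals with
respect to `Ψ′, Ψ̄′` only … defined in the obvious way"*: for ANY linear functional `μ` on the primed algebra `Λ(ι₂)`,
`partialExpect μ : Λ(ι₁ ⊕ₗ ι₂) →ₗ Λ(ι₁)`, `θ_{S₁}θ′_{S₂} ↦ μ(θ′_{S₂}) θ_{S₁}`, characterised by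
**`partialExpect_mapFst_mul_mapSnd`: `∫ F(Ψ)G(Ψ′) dμ(Ψ′) = μ(G)·F(Ψ)`** for all `F ∈ Λ(ι₁)`, `G ∈ Λ(ι₂)`. LEMMA 22 is
proved in two layers: `hNorm_partialExpect_le` — for any `μ` with the monomial bound `|μ(θ′_T)| ≤ h^{#T}` and
`0 ≤ h′ ≤ h`, `‖∫F dμ(Ψ′)‖_{h′} ≤ ‖F‖_h` (this is (318)–(319): expand, bound each primed monomial, `h′^{#S₁}h^{#S₂} ≤ h^{#S}`);
and **`hNorm_partialGaussExpect_le` — the printed statement** for `μ = ∫·dμ_Γ(Ψ′,Ψ̄′)` = the tree's `gaussExpect 𝕜 C` of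
a charged covariance on the primed block with `√‖Γ‖₍₂₎ ≤ h` (the monomial bound being (313), Hadamard, file
`QED3GaussianIntegralBound.lean`) and `0 ≤ h′ ≤ h`. No named facts, no `sorry`.
-/

noncomputable section

open Finset

namespace Literature.MathematicalPhysics.QuantumFieldTheory.Dimock2011to13

namespace QED3TorusI

open Literature.MathematicalPhysics.QuantumLattice
open Literature.MathematicalPhysics.QuantumLattice.GrassmannAlgebra

variable {𝕜 : Type*} [RCLike 𝕜]

/-! ## Two blocks of generators: `Λ(ι₁ ⊕ₗ ι₂)` = unprimed fields `Ψ, Ψ̄` (block `ι₁`) and primed fields `Ψ′, Ψ̄′` (block `ι₂`) -/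

section TwoBlocks

variable {ι₁ ι₂ : Type*} [LinearOrder ι₁] [Fintype ι₁] [LinearOrder ι₂] [Fintype ι₂]

/-- The unprimed letters `Y_n, Ȳ_m` of a set of generators of `Λ(ι₁ ⊕ₗ ι₂)`. [cite: Dimock2002QED3TorusI, App. B (315) p.64 L13–17] -/
def fstPart (S : Finset (ι₁ ⊕ₗ ι₂)) : Finset ι₁ := Finset.univ.filter fun a => toLex (Sum.inl a) ∈ S

/-- The primed letters `X_ℓ, X̄_k` of a set of generators of `Λ(ι₁ ⊕ₗ ι₂)`. [cite: Dimock2002QED3TorusI, App. B (315) p.64 L13–17] -/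
def sndPart (S : Finset (ι₁ ⊕ₗ ι₂)) : Finset ι₂ := Finset.univ.filter fun b => toLex (Sum.inr b) ∈ S

omit [Fintype ι₂] in
/-- Membership in the unprimed block. [folklore] -/
private theorem mem_fstPart {S : Finset (ι₁ ⊕ₗ ι₂)} {a : ι₁} : a ∈ fstPart S ↔ toLex (Sum.inl a) ∈ S := by
  simp [fstPart]

omit [Fintype ι₁] in
/-- Membership in the primed block. [folklore] -/
private theorem mem_sndPart {S : Finset (ι₁ ⊕ₗ ι₂)} {b : ι₂} : b ∈ sndPart S ↔ toLex (Sum.inr b) ∈ S := by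
  simp [sndPart]

/-- A set of generators is the disjoint union of its two blocks; in particular `#S = #S₁ + #S₂` — the degree
`n + m + ℓ + k` of (315)–(316) splits into unprimed `n + m` and primed `ℓ + k`. [cite: Dimock2002QED3TorusI, App. B (315)–(316) p.64 L13–19] -/
theorem card_fstPart_add_card_sndPart (S : Finset (ι₁ ⊕ₗ ι₂)) :
    (fstPart S).card + (sndPart S).card = S.card := by
  classical
  let e₁ : ι₁ ↪ ι₁ ⊕ₗ ι₂ := ⟨fun a => toLex (Sum.inl a), fun a b h => by simpa using h⟩
  let e₂ : ι₂ ↪ ι₁ ⊕ₗ ι₂ := ⟨fun b => toLex (Sum.inr b), fun a b h => by simpa using h⟩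
  have hS : S = (fstPart S).map e₁ ∪ (sndPart S).map e₂ := by
    ext w
    obtain ⟨w, rfl⟩ := toLex.surjective w
    rcases w with a | b
    · simp [e₁, e₂, mem_fstPart]
    · simp [e₁, e₂, mem_sndPart]
  have hd : Disjoint ((fstPart S).map e₁) ((sndPart S).map e₂) := by
    rw [Finset.disjoint_left]
    intro w hw1 hw2
    obtain ⟨a, _, rfl⟩ := Finset.mem_map.1 hw1
    obtain ⟨b, _, hb⟩ := Finset.mem_map.1 hw2
    simp [e₁, e₂] at hb
  conv_rhs => rw [hS]
  rw [Finset.card_union_of_disjoint hd, Finset.card_map, Finset.card_map]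

/-- **Gaussian integrals with respect to the primed fields only, "defined in the obvious way"**: given a linear functional
`μ` on the primed block (e.g. `∫·dμ_Γ(Ψ′,Ψ̄′)`), the linear map `Λ(ι₁ ⊕ₗ ι₂) → Λ(ι₁)` which integrates the primed factor
of each monomial and keeps the unprimed factor: `θ_{S₁}θ′_{S₂} ↦ μ(θ′_{S₂}) θ_{S₁}` (all unprimed letters precede all
primed ones in `ι₁ ⊕ₗ ι₂`, so every basis monomial is such a product).
[cite: Dimock2002QED3TorusI, App. B p.64 L20–21 («Gaussian integrals with respect to Ψ′, Ψ̄′ only are defined in the obvious way»)] -/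
def partialExpect (μ : GrassmannAlgebra 𝕜 ι₂ →ₗ[𝕜] 𝕜) :
    GrassmannAlgebra 𝕜 (ι₁ ⊕ₗ ι₂) →ₗ[𝕜] GrassmannAlgebra 𝕜 ι₁ :=
  (grassmannBasis 𝕜 (ι₁ ⊕ₗ ι₂)).constr 𝕜 fun S =>
    μ (grassmannBasis 𝕜 ι₂ (sndPart S)) • grassmannBasis 𝕜 ι₁ (fstPart S)

/-- On monomials: `∫ θ_{S₁}θ′_{S₂} dμ(Ψ′) = μ(θ′_{S₂}) θ_{S₁}`. [cite: Dimock2002QED3TorusI, App. B (318) p.64 L22–25] -/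
theorem partialExpect_grassmannBasis (μ : GrassmannAlgebra 𝕜 ι₂ →ₗ[𝕜] 𝕜) (S : Finset (ι₁ ⊕ₗ ι₂)) :
    partialExpect μ (grassmannBasis 𝕜 (ι₁ ⊕ₗ ι₂) S) =
      μ (grassmannBasis 𝕜 ι₂ (sndPart S)) • grassmannBasis 𝕜 ι₁ (fstPart S) := by
  rw [partialExpect, Module.Basis.constr_basis]

/-- The expansion `∫F dμ(Ψ′) = Σ_S c_S(F) μ(θ′_{S₂}) θ_{S₁}` (318). [cite: Dimock2002QED3TorusI, App. B (318) p.64 L22–25] -/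
theorem partialExpect_apply (μ : GrassmannAlgebra 𝕜 ι₂ →ₗ[𝕜] 𝕜) (F : GrassmannAlgebra 𝕜 (ι₁ ⊕ₗ ι₂)) :
    partialExpect μ F = ∑ S, coeff F S • (μ (grassmannBasis 𝕜 ι₂ (sndPart S)) • grassmannBasis 𝕜 ι₁ (fstPart S)) := by
  rw [partialExpect, Module.Basis.constr_apply_fintype]
  simp only [Module.Basis.equivFun_apply]

/-- **LEMMA 22, abstract form.** If the functional `μ` on the primed block obeys the monomial bound `|μ(θ′_T)| ≤ h^{#T}`
(for `∫·dμ_Γ` this is (313): Hadamard), and `0 ≤ h′ ≤ h`, then `‖∫F dμ(Ψ′)‖_{h′} ≤ ‖F‖_h` — the estimate (319).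
[cite: Dimock2002QED3TorusI, App. B Lemma 22 (317)–(319) p.64 L18–30] -/
theorem hNorm_partialExpect_le (μ : GrassmannAlgebra 𝕜 ι₂ →ₗ[𝕜] 𝕜) {h h' : ℝ} (hh' : 0 ≤ h') (hle : h' ≤ h)
    (hμ : ∀ T : Finset ι₂, ‖μ (grassmannBasis 𝕜 ι₂ T)‖ ≤ h ^ T.card) (F : GrassmannAlgebra 𝕜 (ι₁ ⊕ₗ ι₂)) :
    hNorm h' (partialExpect μ F) ≤ hNorm h F := by
  have hh : 0 ≤ h := hh'.trans hle
  rw [partialExpect_apply]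
  refine (hNorm_sum_le hh' _ _).trans ?_
  rw [hNorm]
  refine Finset.sum_le_sum fun S _ => ?_
  rw [hNorm_smul, hNorm_smul, hNorm_grassmannBasis, mul_comm]
  refine mul_le_mul_of_nonneg_right ?_ (norm_nonneg _)
  calc ‖μ (grassmannBasis 𝕜 ι₂ (sndPart S))‖ * h' ^ (fstPart S).card
      ≤ h ^ (sndPart S).card * h ^ (fstPart S).card :=
        mul_le_mul (hμ _) (pow_le_pow_left₀ hh' hle _) (pow_nonneg hh' _) (pow_nonneg hh _)
    _ = h ^ S.card := by rw [← pow_add, add_comm, card_fstPart_add_card_sndPart]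

end TwoBlocks

/-! ### Transport of monomials along an order embedding of generators, and the two-block factorisation -/

section Transport

variable {κ J : Type*} [LinearOrder κ] [Fintype κ] [LinearOrder J] [Fintype J]

omit [Fintype J] in
/-- Extension by zero maps basis vectors to basis vectors (tree: `GrassmannGaussianSources.extendByZero_single`,
re-proved to keep the imports light). [folklore] -/
private theorem extendByZero_single (f : κ ↪o J) (i : κ) :
    Function.ExtendByZero.linearMap 𝕜 f (Pi.single i 1) = Pi.single (f i) 1 := by
  ext j
  change Function.extend f (Pi.single i (1 : 𝕜)) 0 j = (Pi.single (f i) (1 : 𝕜) : J → 𝕜) j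
  by_cases hj : ∃ k, f k = j
  · obtain ⟨k, rfl⟩ := hj
    rw [f.injective.extend_apply]
    by_cases hki : k = i
    · subst hki; rw [Pi.single_eq_same, Pi.single_eq_same]
    · rw [Pi.single_eq_of_ne hki, Pi.single_eq_of_ne (fun h => hki (f.injective h))]
  · rw [Function.extend_apply' _ _ _ hj, Pi.zero_apply, Pi.single_eq_of_ne]
    rintro rfl
    exact hj ⟨i, rfl⟩

omit [Fintype J] in
/-- The algebra embedding `Λ(κ) → Λ(J)` induced by an order embedding of generators sends `θ_i ↦ θ_{f i}`
(tree: `GrassmannGaussianSources.map_extendByZero_gen`). [folklore] -/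
private theorem map_extendByZero_gen (f : κ ↪o J) (i : κ) :
    ExteriorAlgebra.map (Function.ExtendByZero.linearMap 𝕜 f) (gen 𝕜 i) = gen 𝕜 (f i) := by
  rw [gen, ExteriorAlgebra.map_apply_ι, extendByZero_single, gen]

/-- … and monomials to monomials: `θ_s ↦ θ_{f(s)}` (a monomial `Ψ(Y_n)` of a sub-block is a monomial of the whole algebra).
[cite: Dimock2002QED3TorusI, App. B (315) p.64 L13–17] -/
theorem map_extendByZero_grassmannBasis (f : κ ↪o J) (s : Finset κ) :
    ExteriorAlgebra.map (Function.ExtendByZero.linearMap 𝕜 f) (grassmannBasis 𝕜 κ s) =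
      grassmannBasis 𝕜 J (s.map f.toEmbedding) := by
  induction s using Finset.induction_on_min with
  | empty => simp
  | insert a u hmin ih =>
    have hmin' : ∀ x ∈ u.map f.toEmbedding, f a < x := by
      intro x hx
      obtain ⟨b, hb, rfl⟩ := Finset.mem_map.1 hx
      exact f.strictMono (hmin b hb)
    rw [grassmannBasis_insert_of_forall_lt 𝕜 hmin, map_mul, map_extendByZero_gen, ih, Finset.map_insert]
    change gen 𝕜 (f a) * _ = grassmannBasis 𝕜 J (insert (f a) (u.map f.toEmbedding))
    rw [grassmannBasis_insert_of_forall_lt 𝕜 hmin']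

end Transport

section TwoBlocks'

variable {ι₁ ι₂ : Type*} [LinearOrder ι₁] [Fintype ι₁] [LinearOrder ι₂] [Fintype ι₂]

/-- The order embedding of the unprimed generators `Ψ(y), Ψ̄(y)`. [cite: Dimock2002QED3TorusI, App. B (315) p.64 L13–14] -/
def inlEmb : ι₁ ↪o ι₁ ⊕ₗ ι₂ := OrderEmbedding.ofStrictMono (fun a => toLex (Sum.inl a)) Sum.Lex.inl_strictMono

/-- The order embedding of the primed generators `Ψ′(x), Ψ̄′(x)`. [cite: Dimock2002QED3TorusI, App. B (315) p.64 L13–14] -/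
def inrEmb : ι₂ ↪o ι₁ ⊕ₗ ι₂ := OrderEmbedding.ofStrictMono (fun b => toLex (Sum.inr b)) Sum.Lex.inr_strictMono

omit [Fintype ι₁] [Fintype ι₂] in
/-- Unfolding. [folklore] -/
@[simp] private theorem inlEmb_apply (a : ι₁) : (inlEmb : ι₁ ↪o ι₁ ⊕ₗ ι₂) a = toLex (Sum.inl a) := rfl

omit [Fintype ι₁] [Fintype ι₂] in
/-- Unfolding. [folklore] -/
@[simp] private theorem inrEmb_apply (b : ι₂) : (inrEmb : ι₂ ↪o ι₁ ⊕ₗ ι₂) b = toLex (Sum.inr b) := rfl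

/-- The embedding `F(Ψ,Ψ̄) ↦ F` of the unprimed algebra into `Λ(ι₁ ⊕ₗ ι₂)`. [cite: Dimock2002QED3TorusI, App. B (315) p.64 L13–17] -/
abbrev mapFst : GrassmannAlgebra 𝕜 ι₁ →ₐ[𝕜] GrassmannAlgebra 𝕜 (ι₁ ⊕ₗ ι₂) :=
  ExteriorAlgebra.map (Function.ExtendByZero.linearMap 𝕜 (inlEmb : ι₁ ↪o ι₁ ⊕ₗ ι₂))

/-- The embedding `G(Ψ′,Ψ̄′) ↦ G` of the primed algebra into `Λ(ι₁ ⊕ₗ ι₂)`. [cite: Dimock2002QED3TorusI, App. B (315) p.64 L13–17] -/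
abbrev mapSnd : GrassmannAlgebra 𝕜 ι₂ →ₐ[𝕜] GrassmannAlgebra 𝕜 (ι₁ ⊕ₗ ι₂) :=
  ExteriorAlgebra.map (Function.ExtendByZero.linearMap 𝕜 (inrEmb : ι₂ ↪o ι₁ ⊕ₗ ι₂))

/-- A two-block set of generators is recovered from its blocks (the decomposition (315)). [cite: Dimock2002QED3TorusI, App. B (315) p.64 L13–17] -/
theorem map_fstPart_union_map_sndPart (S : Finset (ι₁ ⊕ₗ ι₂)) :
    (fstPart S).map (inlEmb : ι₁ ↪o ι₁ ⊕ₗ ι₂).toEmbedding ∪ (sndPart S).map (inrEmb : ι₂ ↪o ι₁ ⊕ₗ ι₂).toEmbedding = S := by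
  ext w
  obtain ⟨w, rfl⟩ := toLex.surjective w
  rcases w with a | b
  · simp [mem_fstPart, Finset.mem_map]
  · simp [mem_sndPart, Finset.mem_map]

omit [Fintype ι₂] in
/-- The unprimed block of `S₁ ⊔ S₂′` is `S₁`. [cite: Dimock2002QED3TorusI, App. B (315) p.64 L13–17] -/
theorem fstPart_union (S₁ : Finset ι₁) (S₂ : Finset ι₂) :
    fstPart (S₁.map (inlEmb : ι₁ ↪o ι₁ ⊕ₗ ι₂).toEmbedding ∪ S₂.map (inrEmb : ι₂ ↪o ι₁ ⊕ₗ ι₂).toEmbedding) = S₁ := by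
  ext a
  simp [mem_fstPart, Finset.mem_map]

omit [Fintype ι₁] in
/-- The primed block of `S₁ ⊔ S₂′` is `S₂`. [cite: Dimock2002QED3TorusI, App. B (315) p.64 L13–17] -/
theorem sndPart_union (S₁ : Finset ι₁) (S₂ : Finset ι₂) :
    sndPart (S₁.map (inlEmb : ι₁ ↪o ι₁ ⊕ₗ ι₂).toEmbedding ∪ S₂.map (inrEmb : ι₂ ↪o ι₁ ⊕ₗ ι₂).toEmbedding) = S₂ := by
  ext b
  simp [mem_sndPart, Finset.mem_map]

omit [Fintype ι₁] [Fintype ι₂] in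
/-- No sign is picked up when the right block already sits to the right: if no letter of `s` precedes a letter of
`t ∖ s` then `berezinSign s t = 1`. [folklore] -/
private theorem berezinSign_eq_one_of_forall_not_lt {s t : Finset (ι₁ ⊕ₗ ι₂)} (h : ∀ x ∈ s, ∀ y ∈ t \ s, ¬x < y) :
    berezinSign s t = 1 := by
  unfold berezinSign
  rw [Finset.card_eq_zero.2]
  · simp
  · exact Finset.filter_eq_empty_iff.2 fun p hp => h p.1 (Finset.mem_product.1 hp).1 p.2 (Finset.mem_product.1 hp).2

/-- **Every monomial of `Λ(ι₁ ⊕ₗ ι₂)` is an unprimed monomial times a primed monomial**, `θ_S = θ_{S₁} θ′_{S₂}` — no sign,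
because all unprimed letters precede all primed ones (this is the form (315) `Ψ(Y_n)Ψ̄(Ȳ_m)Ψ′(X_ℓ)Ψ̄′(X̄_k)`).
[cite: Dimock2002QED3TorusI, App. B (315) p.64 L13–17] -/
theorem grassmannBasis_map_union (S₁ : Finset ι₁) (S₂ : Finset ι₂) :
    mapFst (𝕜 := 𝕜) (grassmannBasis 𝕜 ι₁ S₁) * mapSnd (grassmannBasis 𝕜 ι₂ S₂) =
      grassmannBasis 𝕜 (ι₁ ⊕ₗ ι₂)
        (S₁.map (inlEmb : ι₁ ↪o ι₁ ⊕ₗ ι₂).toEmbedding ∪ S₂.map (inrEmb : ι₂ ↪o ι₁ ⊕ₗ ι₂).toEmbedding) := by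
  set u := S₁.map (inlEmb : ι₁ ↪o ι₁ ⊕ₗ ι₂).toEmbedding with hu
  set s := S₂.map (inrEmb : ι₂ ↪o ι₁ ⊕ₗ ι₂).toEmbedding with hs
  have hd : Disjoint u s := by
    rw [Finset.disjoint_left]
    intro w hw1 hw2
    obtain ⟨a, _, rfl⟩ := Finset.mem_map.1 hw1
    obtain ⟨b, _, hb⟩ := Finset.mem_map.1 hw2
    simp at hb
  rw [mapFst, mapSnd, map_extendByZero_grassmannBasis, map_extendByZero_grassmannBasis, ← hu, ← hs,
    grassmannBasis_mul_grassmannBasis_of_disjoint 𝕜 hd, berezinSign_eq_one_of_forall_not_lt, Units.val_one,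
    Int.cast_one, one_smul]
  · congr 1
  · intro x hx y hy
    obtain ⟨b, _, rfl⟩ := Finset.mem_map.1 hx
    have hy' : y ∈ u := by
      rw [Finset.mem_sdiff, Finset.mem_union] at hy
      exact hy.1.resolve_right hy.2
    obtain ⟨a, _, rfl⟩ := Finset.mem_map.1 hy'
    exact Sum.Lex.not_inr_lt_inl

/-- The monomial `θ_S` factors as `θ_{S₁}θ′_{S₂}` with `S₁, S₂` its two blocks. [cite: Dimock2002QED3TorusI, App. B (315) p.64 L13–17] -/
theorem grassmannBasis_sumLex (S : Finset (ι₁ ⊕ₗ ι₂)) :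
    grassmannBasis 𝕜 (ι₁ ⊕ₗ ι₂) S = mapFst (𝕜 := 𝕜) (grassmannBasis 𝕜 ι₁ (fstPart S)) * mapSnd (grassmannBasis 𝕜 ι₂ (sndPart S)) := by
  rw [grassmannBasis_map_union, map_fstPart_union_map_sndPart]

/-- **The partial integral integrates the primed factor and keeps the unprimed one**: `∫ F(Ψ)G(Ψ′) dμ(Ψ′) = μ(G)·F(Ψ)`
for every `F ∈ Λ(ι₁)`, `G ∈ Λ(ι₂)` — the defining property *"Gaussian integrals with respect to `Ψ′, Ψ̄′` only are defined in
the obvious way"*. [cite: Dimock2002QED3TorusI, App. B p.64 L20–21] -/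
theorem partialExpect_mapFst_mul_mapSnd (μ : GrassmannAlgebra 𝕜 ι₂ →ₗ[𝕜] 𝕜) (F : GrassmannAlgebra 𝕜 ι₁)
    (G : GrassmannAlgebra 𝕜 ι₂) : partialExpect μ (mapFst F * mapSnd G) = μ G • F := by
  have hF : F = ∑ S₁, coeff F S₁ • grassmannBasis 𝕜 ι₁ S₁ := ((grassmannBasis 𝕜 ι₁).sum_repr F).symm
  have hG : G = ∑ S₂, coeff G S₂ • grassmannBasis 𝕜 ι₂ S₂ := ((grassmannBasis 𝕜 ι₂).sum_repr G).symm
  calc partialExpect μ (mapFst F * mapSnd G)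
      = ∑ S₁, ∑ S₂, (coeff F S₁ * coeff G S₂ * μ (grassmannBasis 𝕜 ι₂ S₂)) • grassmannBasis 𝕜 ι₁ S₁ := by
        conv_lhs => rw [hF, hG]
        rw [map_sum, map_sum, Finset.sum_mul_sum, map_sum]
        refine Finset.sum_congr rfl fun S₁ _ => ?_
        rw [map_sum]
        refine Finset.sum_congr rfl fun S₂ _ => ?_
        rw [map_smul, map_smul, smul_mul_smul_comm, map_smul, grassmannBasis_map_union, partialExpect_grassmannBasis,
          fstPart_union, sndPart_union, smul_smul]
    _ = μ G • F := by
        conv_rhs => rw [hG, map_sum, Finset.sum_smul]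
        rw [Finset.sum_comm]
        refine Finset.sum_congr rfl fun S₂ _ => ?_
        rw [map_smul, smul_eq_mul]
        conv_rhs => rw [hF, Finset.smul_sum]
        refine Finset.sum_congr rfl fun S₁ _ => ?_
        rw [smul_smul]
        congr 1
        ring

end TwoBlocks'


/-! ### LEMMA 22 as printed: Gaussian integration of the primed fields -/

section Gaussian

variable {ι₁ ι₂ : Type*} [LinearOrder ι₁] [Fintype ι₁] [LinearOrder ι₂] [Fintype ι₂]

/-- **LEMMA 22.** *"If `h′, √‖Γ‖₍₂₎ ≤ h` then `‖∫F(Ψ,Ψ̄,Ψ′,Ψ̄′)dμ_Γ(Ψ′,Ψ̄′)‖_{h′} ≤ ‖F‖_h`"* (317), for the Gaussian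
integral `∫·dμ_Γ(Ψ′,Ψ̄′)` = the tree's `gaussExpect 𝕜 C` of a charged covariance `C` on the primed generators (two-point
function `Γ = contr 𝕜 C`, moments = determinants (309)), `0 ≤ h′`.
[cite: Dimock2002QED3TorusI, App. B Lemma 22 (317) p.64 L18–21, proof (318)–(319) L22–30] -/
theorem hNorm_partialGaussExpect_le (q : ι₂ → Bool) (C : Matrix ι₂ ι₂ 𝕜) (hC : ∀ X Y, q X = q Y → C X Y = 0)
    {h h' : ℝ} (hh' : 0 ≤ h') (hle : h' ≤ h) (hΓ : Real.sqrt (twoNorm q (contr 𝕜 C)) ≤ h)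
    (F : GrassmannAlgebra 𝕜 (ι₁ ⊕ₗ ι₂)) :
    hNorm h' (partialExpect (gaussExpect 𝕜 C) F) ≤ hNorm h F := by
  obtain ⟨hh, hrow⟩ := rowBound_of_sqrt_twoNorm_le q (contr 𝕜 C) hΓ
  exact hNorm_partialExpect_le _ hh' hle (norm_gaussExpect_grassmannBasis_le_pow q C hC hh hrow) F

end Gaussian

end QED3TorusI

end Literature.MathematicalPhysics.QuantumFieldTheory.Dimock2011to13
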